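import Mathlib
import Summits.Ventures.PercRepro2.SwOutCrossJunctionQSides
import Summits.Ventures.PercRepro2.SwOutCrossJunctionBase

/-!
# The base read off a core-kind class point of a cross junction (blind cell PercRepro2, night-4
g24, 2026-08-28; proofs/NIGHT4-G24.md §3)

At a core-kind `Q`-point `ζ` the base `baseX ζ` (the blue side of `h` flipped to red, the u–`p i`
and cross edges forced red, the outside edges of the `p i` forced blue) has every edge at `h` and
at `u` red (`baseX_h_edge`, `baseX_u_edge`); an arm without dropped vertices lies on ONE side
(`arm_side`: inside the red side `C_R(h) ∖ C_B(h)` or inside the blue side), its inside edges keep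
their colour on the red side and flip on the blue side, its boundary edges are blue
(`baseX_bdry`); every arm vertex is red-connected to `h` inside its arm (`arm_conn_baseX`: the
red path of `ζ` — or of `blue ζ` — from `h` is followed, its last entry into the arm being an
edge from `h`, or from `u` whose partner edge at `h` has the same colour).  Hence the red cluster
of `h` at the base is the whole structure (`cluster_baseX_h`), the blue clusters of `h` and `u`
are trivial, the extended hull of the base is that of the point (`extHull_baseX`), and the arms
read off the base are the arms of the point (`uArmsX_baseX`, `farArmsX_baseX`).
-/

namespace Summit.Ventures.PercRepro2

namespace CrossArm

open Hull LocRows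

variable {V : Type*} {E : Type*} [Fintype E] [DecidableEq E]

open scoped Classical

variable {ends : E → Sym2 V} {X : Type*} {U : Set V} {ξ : Config E} {l h o u : V} {p : X → V}
  {G : SimpleGraph X} {r : X}

section Colours

variable (hj : CrossJunctionQ ends U h u p G o r) (hl : l ∉ U) {ζ : Config E}
  (hζ : ζ ∈ swOutSide ends l h o U ξ) (hk : CoreKind ends U h u ζ)
include hj hl hζ hk

/-- **Every edge at `h` is red at the base.** -/
lemma CrossJunctionQ.baseX_h_edge {e : E} {x : V} (he : ends e = s(h, x)) :
    baseX ends h u p ζ e = true := by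
  have hxp : ∀ i, p i ∉ ends e := by
    intro i hi
    rw [he] at hi
    rcases Sym2.mem_iff.1 hi with h' | h'
    · exact hj.hne_hp i h'.symm
    · exact hj.hnadj_p i e (by rw [he, ← h'])
  rw [baseX_apply_not_p hxp]
  by_cases hx : x ∈ bside ends ζ h
  · rw [flip_apply_of_mem (show e ∈ touches ends (bside ends ζ h) from ⟨x, hx, h, ends_swap he⟩)]
    cases hc : ζ e with
    | false => rfl
    | true => exact absurd (mem_cluster_of_edge (mem_cluster_self _ _ _) hc he) hx.2
  · have hnt : e ∉ touches ends (bside ends ζ h) := by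
      rintro ⟨y, hy, z, hyz⟩
      rw [he, Sym2.eq_iff] at hyz
      rcases hyz with ⟨h1, -⟩ | ⟨-, h2⟩
      · rw [← h1] at hy; exact hy.2 (mem_cluster_self _ _ _)
      · rw [← h2] at hy; exact hx hy
    rw [flip_apply_of_notMem hnt]
    cases hc : ζ e with
    | true => rfl
    | false =>
      exfalso
      have hb : blue ζ e = true := by rw [blue_eq_true_iff]; exact hc
      have hxB : x ∈ cluster ends (blue ζ) h := mem_cluster_of_edge (mem_cluster_self _ _ _) hb he
      have hxR : x ∈ cluster ends ζ h := by
        by_contra hxR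
        exact hx ⟨hxB, hxR⟩
      rcases hj.eq_h_or_u_of_core hl hζ hk hxR hxB with rfl | rfl
      · exact hj.hloop_h e he
      · exact hj.hnadj e he

/-- **Every edge at `u` is red at the base.** -/
lemma CrossJunctionQ.baseX_u_edge {e : E} {x : V} (he : ends e = s(u, x)) :
    baseX ends h u p ζ e = true := by
  by_cases hxp : ∃ i, x = p i
  · obtain ⟨i, rfl⟩ := hxp
    exact crossForce_UP he
  · have hxp' : ∀ i, x ≠ p i := fun i h' => hxp ⟨i, h'⟩
    have hnp : ∀ i, p i ∉ ends e := by
      intro i hi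
      rw [he] at hi
      rcases Sym2.mem_iff.1 hi with h' | h'
      · exact hj.hne_up i h'.symm
      · exact hxp' i h'.symm
    have hxu : x ≠ u := fun h' => hj.hloop_u e (by rw [he, h'])
    have hxh : x ≠ h := fun h' => hj.hnadj e (by rw [he, h', Sym2.eq_swap])
    obtain ⟨e', he'⟩ := hj.hu_adj_h e x he hxp'
    have hc := hj.u_edge_eq_h_edge hl hζ hk he he'
    rw [baseX_apply_not_p hnp]
    cases hce : ζ e with
    | true =>
      -- `x` and `u` are in the red cluster of `h`: neither is on the blue side
      have hxR : x ∈ cluster ends ζ h :=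
        mem_cluster_of_edge (mem_cluster_self _ _ _) (by rw [← hc, hce]) (ends_swap he')
      have huR : u ∈ cluster ends ζ h := mem_cluster_of_edge hxR hce (ends_swap he)
      have hnt : e ∉ touches ends (bside ends ζ h) := by
        rintro ⟨y, hy, z, hyz⟩
        rw [he, Sym2.eq_iff] at hyz
        rcases hyz with ⟨h1, -⟩ | ⟨-, h2⟩
        · rw [← h1] at hy; exact hy.2 huR
        · rw [← h2] at hy; exact hy.2 hxR
      rw [flip_apply_of_notMem hnt, hce]
    | false =>
      -- `x` is on the blue side: the edge is flipped
      have hb : blue ζ e' = true := by rw [blue_eq_true_iff, ← hc, hce]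
      have hxB : x ∈ cluster ends (blue ζ) h :=
        mem_cluster_of_edge (mem_cluster_self _ _ _) hb (ends_swap he')
      have hxR : x ∉ cluster ends ζ h := by
        intro hxR
        rcases hj.eq_h_or_u_of_core hl hζ hk hxR hxB with h' | h'
        · exact hxh h'
        · exact hxu h'
      rw [flip_apply_of_mem (show e ∈ touches ends (bside ends ζ h) from
        ⟨x, ⟨hxB, hxR⟩, u, ends_swap he⟩), hce]
      rfl

/-- **An arm without dropped vertices lies on one side.** -/
lemma CrossJunctionQ.arm_side {P : Set V} (hP : P ∈ armsC ends h u ζ) (hPp : ∀ i, p i ∉ P) :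
    P ⊆ rside ends ζ h ∨ P ⊆ bside ends ζ h := by
  obtain ⟨x₀, hx₀⟩ := armsC_nonempty hP
  have hHU : extHull ends ζ h u ⊆ U := extHull_subset_of_coreKind hζ hk
  -- the side of a vertex spreads along the arm
  have spread : ∀ (S : Set V), (∀ a ∈ S, ∀ b, b ∈ hull ends ζ h → b ≠ h → b ≠ u →
      (∃ e, ends e = s(a, b)) → b ∈ S) → ∀ x ∈ P, x ∈ S → ∀ y ∈ P, y ∈ S := by
    intro S hS x hx hxS y hy
    obtain ⟨z, hzH, hzh, hzu, rfl⟩ := exists_of_mem_armsC hP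
    have hyx : y ∈ armC ends h u ζ x := by rw [armC_eq_of_mem hx]; exact hy
    refine mem_of_conn_of_closed (ends := ends) (ω := armConfigC ends h u ζ)
      (S := {v | v ∈ armC ends h u ζ z ∧ v ∈ S}) ?_ ⟨hx, hxS⟩ hyx |>.2
    rintro a ⟨haP, haS⟩ b hab
    obtain ⟨_, e, he, hends⟩ := openGraph_adj.1 hab
    have hbP : b ∈ armC ends h u ζ z := mem_cluster_of_adj haP hab
    have hbH := armC_subset hzH hzh hzu hbP
    have hbh : b ≠ h := fun h' => hbH.2 (by rw [h']; exact Or.inl rfl)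
    have hbu : b ≠ u := fun h' => hbH.2 (by rw [h']; exact Or.inr rfl)
    refine ⟨hbP, hS a haS b ?_ hbh hbu ⟨e, hends⟩⟩
    exact hj.mem_hull_of_mem_extHull hl hζ hk hbH.1 hbu fun i h' => hPp i (h' ▸ hbP)
  have hx₀h : x₀ ∈ hull ends ζ h := hj.mem_hull_of_mem_arm hl hζ hk hP hPp hx₀
  have hcoreP : ∀ x ∈ P, x ∈ cluster ends ζ h → x ∈ cluster ends (blue ζ) h → False := by
    intro x hx hxR hxB
    rcases hj.eq_h_or_u_of_core hl hζ hk hxR hxB with rfl | rfl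
    · exact (armsC_subset hP x hx).2.1 rfl
    · exact (armsC_subset hP x hx).2.2 rfl
  have hside : ∀ b ∈ hull ends ζ h, b ≠ h → b ≠ u →
      b ∈ rside ends ζ h ∨ b ∈ bside ends ζ h := by
    intro b hb hbh hbu
    by_cases hbR : b ∈ cluster ends ζ h
    · left
      refine ⟨hbR, fun hbB => ?_⟩
      rcases hj.eq_h_or_u_of_core hl hζ hk hbR hbB with h' | h'
      · exact hbh h'
      · exact hbu h'
    · right
      rcases hb with hb | hb
      · exact absurd hb hbR
      · exact ⟨hb, hbR⟩
  by_cases hx₀R : x₀ ∈ rside ends ζ h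
  · left
    intro y hy
    refine spread (rside ends ζ h) ?_ x₀ hx₀ hx₀R y hy
    intro a ha b hb hbh hbu ⟨e, he⟩
    rcases hside b hb hbh hbu with hbR | hbB
    · exact hbR
    · exact absurd he fun he => no_edge_rside_bside ha hbB he
  · right
    have hx₀B : x₀ ∈ bside ends ζ h := by
      rcases hside x₀ hx₀h (armsC_subset hP x₀ hx₀).2.1 (armsC_subset hP x₀ hx₀).2.2 with h' | h'
      · exact absurd h' hx₀R
      · exact h'
    intro y hy
    refine spread (bside ends ζ h) ?_ x₀ hx₀ hx₀B y hy
    intro a ha b hb hbh hbu ⟨e, he⟩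
    rcases hside b hb hbh hbu with hbR | hbB
    · exact absurd (ends_swap he) fun he => no_edge_rside_bside hbR ha he
    · exact hbB

omit hl in
/-- An arm vertex has no edge to a dropped vertex. -/
lemma CrossJunctionQ.arm_no_p {P : Set V} (hP : P ∈ armsC ends h u ζ) (hPp : ∀ i, p i ∉ P) {e : E}
    {x : V} (hx : x ∈ P) (i : X) : ends e ≠ s(x, p i) := by
  intro he
  have hHU : extHull ends ζ h u ⊆ U := extHull_subset_of_coreKind hζ hk
  have hxU : x ∈ U := hHU (armsC_subset hP x hx).1
  rcases hj.hp_in i e x (ends_swap he) hxU with h' | ⟨j, h'⟩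
  · exact (armsC_subset hP x hx).2.2 h'
  · exact hPp j (h' ▸ hx)

omit hl in
/-- An edge at an arm vertex is not at a dropped vertex. -/
lemma CrossJunctionQ.arm_edge_no_p {P : Set V} (hP : P ∈ armsC ends h u ζ) (hPp : ∀ i, p i ∉ P)
    {e : E} {x y : V} (he : ends e = s(x, y)) (hx : x ∈ P) : ∀ i, p i ∉ ends e := by
  intro i hi
  rw [he] at hi
  rcases Sym2.mem_iff.1 hi with h' | h'
  · exact hPp i (h' ▸ hx)
  · exact hj.arm_no_p hζ hk hP hPp hx i (by rw [he, h'])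

omit hl in
/-- **An inside edge of a red-side arm keeps its colour.** -/
lemma CrossJunctionQ.baseX_inside_red {P : Set V} (hP : P ∈ armsC ends h u ζ)
    (hPp : ∀ i, p i ∉ P) (hPr : P ⊆ rside ends ζ h) {e : E} {x y : V} (he : ends e = s(x, y))
    (hx : x ∈ P) (hy : y ∈ P) : baseX ends h u p ζ e = ζ e := by
  rw [baseX_apply_not_p (hj.arm_edge_no_p hζ hk hP hPp he hx), flip_apply_of_notMem]
  rintro ⟨z, hz, w, hzw⟩
  rw [he, Sym2.eq_iff] at hzw
  rcases hzw with ⟨h1, -⟩ | ⟨-, h2⟩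
  · rw [← h1] at hz; exact hz.2 (hPr hx).1
  · rw [← h2] at hz; exact hz.2 (hPr hy).1

omit hl in
/-- **An inside edge of a blue-side arm flips.** -/
lemma CrossJunctionQ.baseX_inside_blue {P : Set V} (hP : P ∈ armsC ends h u ζ)
    (hPp : ∀ i, p i ∉ P) (hPb : P ⊆ bside ends ζ h) {e : E} {x y : V} (he : ends e = s(x, y))
    (hx : x ∈ P) : baseX ends h u p ζ e = !ζ e := by
  rw [baseX_apply_not_p (hj.arm_edge_no_p hζ hk hP hPp he hx),
    flip_apply_of_mem (show e ∈ touches ends (bside ends ζ h) from ⟨x, hPb hx, y, he⟩)]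

/-- **A boundary edge of an arm is blue at the base.** -/
lemma CrossJunctionQ.baseX_bdry {P : Set V} (hP : P ∈ armsC ends h u ζ) (hPp : ∀ i, p i ∉ P)
    {e : E} {x y : V} (he : ends e = s(x, y)) (hx : x ∈ P) (hy : y ∉ extHull ends ζ h u) :
    baseX ends h u p ζ e = false := by
  have hyb : y ∉ bside ends ζ h := fun hy' => hy (Or.inl (bside_subset_hull hy'))
  rw [baseX_apply_not_p (hj.arm_edge_no_p hζ hk hP hPp he hx)]
  rcases hj.arm_side hl hζ hk hP hPp with hPr | hPb
  · rw [flip_apply_of_notMem]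
    · cases hc : ζ e with
      | false => rfl
      | true =>
        exact absurd (show y ∈ extHull ends ζ h u from
          Or.inl (Or.inl (mem_cluster_of_edge (hPr hx).1 hc he))) hy
    · rintro ⟨z, hz, w, hzw⟩
      rw [he, Sym2.eq_iff] at hzw
      rcases hzw with ⟨h1, -⟩ | ⟨-, h2⟩
      · rw [← h1] at hz; exact hz.2 (hPr hx).1
      · rw [← h2] at hz; exact hyb hz
  · rw [flip_apply_of_mem (show e ∈ touches ends (bside ends ζ h) from ⟨x, hPb hx, y, he⟩)]
    cases hc : ζ e with
    | true => rfl
    | false =>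
      have hb : blue ζ e = true := by rw [blue_eq_true_iff]; exact hc
      exact absurd (show y ∈ extHull ends ζ h u from
        Or.inl (Or.inr (mem_cluster_of_edge (hPb hx).1 hb he))) hy

end Colours

end CrossArm

end Summit.Ventures.PercRepro2
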